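import Summits.NavierStokesRegularity.NavierStokesRegularity.Theorems.AdaptedFrequencyAdaptedFrequencyConvergesStubHullTransferZoom
import HarnessLib

/-!
# The route's zoom data with the explicit zoom formula
# (route `AdaptedFrequency`; sub-goal W1 of the enabler `tangentFlowTransfer_finiteAB` for the
# crux `FrequencyRigidity`, stmt-NavierStokesRegularity-2955, line `scaled-energy-split`)

The tree theorem `hullTransfer_zoomData` (stub `stub_hullTransfer` of line
`cloud-frame-effective-tsai`) produces the unit-viscosity zoomed blow-up sequence
`w_k = c_k u♭(νT + c_k² ·, x₀ + c_k ·)` of the viscosity-normalised data `u♭ = ν⁻¹ u(·/ν, ·)`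
along a prescribed positive null sequence of scales `c_k`, with every clause the compactness /
kernel-stability steps consume, but hides the zoom formula behind an existential. Here we re-run
the same construction and record, as an eleventh conjunct, the IDENTIFICATION
`w k = c k • stPull (c k ^ 2) (c k) (ν * T) x₀ (ν⁻¹ • stPull ν⁻¹ 1 0 0 u)`, which the assembly of
`tangentFlowTransfer_finiteAB` needs in order to compare the route's zooms with the
Albritton–Barker zooms of `u` about the same point.
-/

noncomputable section

set_option linter.dupNamespace false

namespace Summit.NavierStokesRegularity.NavierStokesRegularity.Theorems

open scoped Topology
open Literature.Analysis Literature.Analysis.FluidPDE Set Filter MeasureTheory Function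
open Summit.NavierStokesRegularity.NavierStokesRegularity.Theorems.AdaptedFrequencyConverges.CloudFrameEffectiveTsai

/-- **The zoomed, viscosity-normalised blow-up sequence of the hull transfer, with the zoom
formula exposed.** Data: a classical solution `(u, p)` of the unforced Navier–Stokes system
(viscosity `ν > 0`) on `[0, T)`, Leray–Hopf from `u 0`, with the Type-I bound `‖u‖ ≤ C/√(T − t)`
on `(t₁, T)`; an adapted kernel `G` of `u` on `[t₀, T)` with pole `(T, x₀)` and two-sided
Gaussian bounds (constants `c₁, c₂, C₁, C₂`); two-sided pinching `c₀ ≤ (T − t)² H(t) ≤ Cₚ` of the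
adapted enstrophy on a final window `[tₚ, T)`; scales `c_k → 0⁺`. Then (with
`u♭ = ν⁻¹ u(·/ν, ·)`, windows `A_k → −∞`, `w_k = c_k u♭(νT + c_k² ·, x₀ + c_k ·)`) there are
pressures and kernels `g_k` such that, for every `k`: `(w_k, p_k)` is classical with unit
viscosity on `[A_k, 0)`; `‖w_k(t)‖ ≤ C₀/√(−t)` on `(A_k, 0)`; `w_k` is Oseen-mild between window
times; `g_k` is an adapted kernel of `w_k` on `[A_k, 0)` with pole `(0, 0)` under Gaussian bounds
with the constants `(c₁ν^{3/2}, c₂/ν, C₁ν^{3/2}, C₂/ν)`; the adapted frequency is READ OFF the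
original one, `Λ_k(τ) = Λ(T + c_k² τ/ν)`; the pinching is transported,
`c₀ ≤ (−τ)² H_k(τ) ≤ Cₚ` for `τ < 0` with `tₚ ≤ T + c_k² τ/ν`; and, in addition to
`hullTransfer_zoomData`, the zoom formula
`w k = c k • stPull (c k ^ 2) (c k) (ν * T) x₀ (ν⁻¹ • stPull ν⁻¹ 1 0 0 u)` is recorded.
[folklore] -/
theorem finiteAB_hullTransfer_zoomData_explicit : ∀ (ν T : ℝ), 0 < ν → 0 < T → ∀ (u : ℝ → EuclideanSpace ℝ (Fin 3) → EuclideanSpace ℝ (Fin 3)) (p : ℝ → EuclideanSpace ℝ (Fin 3) → ℝ), Literature.Analysis.FluidPDE.IsClassicalNSSolutionOn (Set.Ico 0 T) ν 0 u p → Literature.Analysis.FluidPDE.IsLerayHopfOn T ν 0 (u 0) u → ∀ (C t₁ : ℝ), t₁ < T → (∀ t ∈ Set.Ioo t₁ T, ∀ x, ‖u t x‖ ≤ C / Real.sqrt (T - t)) → ∀ (x₀ : EuclideanSpace ℝ (Fin 3)) (t₀ : ℝ), t₀ ∈ Set.Ico 0 T → ∀ (G : ℝ → EuclideanSpace ℝ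 (Fin 3) → ℝ), Literature.Analysis.FluidPDE.IsAdaptedBackwardKernel ν u (Set.Ico t₀ T) T x₀ G → ∀ (c₁ c₂ C₁ C₂ : ℝ), (∀ t ∈ Set.Ico t₀ T, ∀ x, c₁ * (T - t) ^ (-(3:ℝ) / 2) * Real.exp (-(‖x - x₀‖ ^ 2) / (c₂ * (T - t))) ≤ G t x ∧ G t x ≤ C₁ * (T - t) ^ (-(3:ℝ) / 2) * Real.exp (-(‖x - x₀‖ ^ 2) / (C₂ * (T - t)))) → ∀ (tₚ c₀ Cₚ : ℝ), (∀ t ∈ Set.Ico tₚ T, c₀ ≤ (T - t) ^ 2 * Literature.Analysis.FluidPDE.adaptedEnstrophy u G t ∧ (T - t) ^ 2 * Literature.Analysis.FluidPDE.adaptedEnstrophy u G t ≤ Cₚ) → ∀ (c : ℕ → ℝ), (∀ k, 0 < c k) → Filter.Tendsto c Filter.atTop (nhds 0) → ∃ (C₀ : ℝ) (A : ℕ → ℝ) (w : ℕ → ℝ → EuclideanSpace ℝ (Fin 3) → EuclideanSpace ℝ (Fin 3)) (pw : ℕ → ℝ → EuclideanSpace ℝ (Fin 3) → ℝ) (g :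 ℕ → ℝ → EuclideanSpace ℝ (Fin 3) → ℝ), 0 ≤ C₀ ∧ Filter.Tendsto A Filter.atTop Filter.atBot ∧ (∀ k, A k < 0) ∧ (∀ k, Literature.Analysis.FluidPDE.IsClassicalNSSolutionOn (Set.Ico (A k) 0) 1 0 (w k) (pw k)) ∧ (∀ k, ∀ t ∈ Set.Ioo (A k) 0, ∀ x, ‖w k t x‖ ≤ C₀ / Real.sqrt (-t)) ∧ (∀ k, ∀ s t : ℝ, A k < s → s < t → t < 0 → ∀ x, w k t x = Literature.Analysis.UnboundedOperators.heatExtension (w k s) (t - s) x - Literature.Analysis.FluidPDE.oseenDuhamel 1 s (w k) (w k) t x) ∧ (∀ k, Literature.Analysis.FluidPDE.IsAdaptedBackwardKernel 1 (w k) (Set.Ico (A k) 0) 0 0 (g k)) ∧ (∀ k, ∀ t ∈ Set.Ico (A k) 0, ∀ x, (c₁ * ν ^ ((3:ℝ) / 2)) * ((0:ℝ) - t) ^ (-(3:ℝ) / 2) * Real.exp (-(‖x - (0 : EuclideanSpace ℝ (Fin 3))‖ ^ 2) / ((c₂ / ν) * ((0:ℝ) - t))) ≤ g k t x ∧ g k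 t x ≤ (C₁ * ν ^ ((3:ℝ) / 2)) * ((0:ℝ) - t) ^ (-(3:ℝ) / 2) * Real.exp (-(‖x - (0 : EuclideanSpace ℝ (Fin 3))‖ ^ 2) / ((C₂ / ν) * ((0:ℝ) - t)))) ∧ (∀ k τ, Literature.Analysis.FluidPDE.adaptedFrequency (w k) (g k) 0 τ = Literature.Analysis.FluidPDE.adaptedFrequency u G T (T + c k ^ 2 * τ / ν)) ∧ (∀ k, ∀ τ < 0, tₚ ≤ T + c k ^ 2 * τ / ν → c₀ ≤ (-τ) ^ 2 * Literature.Analysis.FluidPDE.adaptedEnstrophy (w k) (g k) τ ∧ (-τ) ^ 2 * Literature.Analysis.FluidPDE.adaptedEnstrophy (w k) (g k) τ ≤ Cₚ) ∧ (∀ k, w k = c k • Literature.Analysis.FluidPDE.stPull (c k ^ 2) (c k) (ν * T) x₀ (ν⁻¹ • Literature.Analysis.FluidPDE.stPull ν⁻¹ 1 0 0 u)) := by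
  intro ν T hν hT u p hcl hLH C t₁ ht₁T hI x₀ t₀ ht₀ G hK c₁ c₂ C₁ C₂ hGb tₚ c₀ Cₚ hpinch c hc hc0
  -- proof adapted from `hullTransfer_zoomData` (same construction, zoom formula exposed)
  -- the window below the blow-up time on which everything is available
  set a : ℝ := max (max t₁ 0) t₀ with ha
  have ha0 : 0 ≤ a := le_trans (le_max_right _ _) (le_max_left _ _)
  have ht₁a : t₁ ≤ a := le_trans (le_max_left _ _) (le_max_left _ _)
  have ht₀a : t₀ ≤ a := le_max_right _ _
  have haT : a < T := max_lt (max_lt ht₁T hT) ht₀.2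
  -- Type-I bound with a nonnegative constant on `(a, T)`
  set Cp : ℝ := max C 0 with hCp
  have hIp : ∀ t ∈ Ioo a T, ∀ x, ‖u t x‖ ≤ Cp / Real.sqrt (T - t) := by
    intro t ht x
    have h1 := hI t ⟨lt_of_le_of_lt ht₁a ht.1, ht.2⟩ x
    exact h1.trans (div_le_div_of_nonneg_right (le_max_left _ _) (Real.sqrt_nonneg _))
  -- viscosity normalisation
  set ub : ℝ → EuclideanSpace ℝ (Fin 3) → EuclideanSpace ℝ (Fin 3) :=
    ν⁻¹ • stPull ν⁻¹ 1 0 0 u with hub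
  set pb : ℝ → EuclideanSpace ℝ (Fin 3) → ℝ := (ν⁻¹) ^ 2 • stPull ν⁻¹ 1 0 0 p with hpb
  set Gb : ℝ → EuclideanSpace ℝ (Fin 3) → ℝ := stPull ν⁻¹ 1 0 0 G with hGb'
  have hclb : IsClassicalNSSolutionOn (Ico (ν * a) (ν * T)) 1 0 ub pb :=
    isClassicalNSSolutionOn_viscosity_Ico hν (hcl.mono (Ico_subset_Ico_left ha0) (uniqueDiffOn_Ico _ _))
  have hIb : ∀ s ∈ Ioo (ν * a) (ν * T), ∀ y, ‖ub s y‖ ≤ (Cp / Real.sqrt ν) / Real.sqrt (ν * T - s) :=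
    typeI_bound_viscosity hIp hν
  have hKb : IsAdaptedBackwardKernel 1 ub (Ico (ν * a) (ν * T)) (ν * T) x₀ Gb :=
    isAdaptedBackwardKernel_viscosity_Ico (hK.mono (Ico_subset_Ico_left ht₀a) (uniqueDiffOn_Ico _ _)) hν
  have h3 : Module.finrank ℝ (EuclideanSpace ℝ (Fin 3)) = 3 := finrank_euclideanSpace_fin
  have h3' : ((Module.finrank ℝ (EuclideanSpace ℝ (Fin 3)) : ℕ) : ℝ) = 3 := by rw [h3]; norm_num
  -- Gaussian bounds after the viscosity normalisation
  have hGbb : ∀ s ∈ Ico (ν * a) (ν * T), ∀ y,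
      (c₁ * ν ^ ((3:ℝ) / 2)) * (ν * T - s) ^ (-(3:ℝ) / 2) *
          Real.exp (-(‖y - x₀‖ ^ 2) / ((c₂ / ν) * (ν * T - s))) ≤ Gb s y ∧
        Gb s y ≤ (C₁ * ν ^ ((3:ℝ) / 2)) * (ν * T - s) ^ (-(3:ℝ) / 2) *
          Real.exp (-(‖y - x₀‖ ^ 2) / ((C₂ / ν) * (ν * T - s))) := by
    intro s hs y
    have hs' : 0 + ν⁻¹ * s ∈ Ico t₀ T := by
      refine ⟨?_, ?_⟩
      · have : ν * t₀ ≤ s := le_trans (mul_le_mul_of_nonneg_left ht₀a hν.le) hs.1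
        rw [zero_add, le_inv_mul_iff₀' hν]; linarith
      · rw [zero_add, inv_mul_lt_iff₀' hν]; linarith [hs.2]
    have h := gaussian_bounds_viscosity (E := EuclideanSpace ℝ (Fin 3)) (G := G) (T := T) (x₀ := x₀)
      (c₁ := c₁) (c₂ := c₂) (C₁ := C₁) (C₂ := C₂) hν hs.2.le y (by
        rw [h3']
        exact hGb _ hs' y)
    rw [h3'] at h
    exact h
  -- the data
  set C₀ : ℝ := Cp / Real.sqrt ν with hC₀
  set A : ℕ → ℝ := fun k => (ν * a - ν * T) / c k ^ 2 with hA
  set w : ℕ → ℝ → EuclideanSpace ℝ (Fin 3) → EuclideanSpace ℝ (Fin 3) :=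
    fun k => c k • stPull (c k ^ 2) (c k) (ν * T) x₀ ub with hw
  set pw : ℕ → ℝ → EuclideanSpace ℝ (Fin 3) → ℝ :=
    fun k => c k ^ 2 • stPull (c k ^ 2) (c k) (ν * T) x₀ pb with hpw
  set g : ℕ → ℝ → EuclideanSpace ℝ (Fin 3) → ℝ :=
    fun k => (c k ^ 3) • stPull (c k ^ 2) (c k) (ν * T) x₀ Gb with hg
  refine ⟨C₀, A, w, pw, g, ?_, tendsto_window_atBot hν haT hc hc0, ?_, ?_, ?_, ?_, ?_, ?_, ?_, ?_,
    fun k => rfl⟩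
  · -- `0 ≤ C₀`
    exact div_nonneg (le_max_right _ _) (Real.sqrt_nonneg _)
  · -- `A k < 0`
    intro k
    exact div_neg_of_neg_of_pos (by nlinarith) (pow_pos (hc k) 2)
  · -- classical on the windows
    intro k
    exact isClassicalNSSolutionOn_zoom_Ico hclb (hc k) x₀
  · -- Type I
    intro k t ht x
    exact typeI_bound_zoom hIb (hc k) x₀ t ht x
  · -- Oseen-mild between window times
    intro k s t hs hst ht x
    refine oseen_smul_stPull (hc k) (ν * T) x₀ hst (fun X => ?_) x
    have h1 : ν * a < ν * T + c k ^ 2 * s := by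
      have hck : 0 < c k ^ 2 := pow_pos (hc k) 2
      have := (div_lt_iff₀ hck).1 hs
      linarith
    have h2 : ν * T + c k ^ 2 * t < ν * T := by
      have : c k ^ 2 * t < 0 := mul_neg_of_pos_of_neg (pow_pos (hc k) 2) ht
      linarith
    have h12 : ν * T + c k ^ 2 * s < ν * T + c k ^ 2 * t := by
      have := mul_lt_mul_of_pos_left hst (pow_pos (hc k) 2)
      linarith
    exact oseenMild_viscosity_of_typeI_window hν hcl hLH ha0 hIp h1 h12 h2 X
  · -- adapted kernels
    intro k
    have h := isAdaptedBackwardKernel_zoom_Ico hKb (hc k)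
    rw [h3] at h
    exact h
  · -- Gaussian bounds, same constants for all `k`
    intro k t ht y
    have ht' : ν * T + c k ^ 2 * t ∈ Ico (ν * a) (ν * T) := by
      refine ⟨?_, ?_⟩
      · have hck : 0 < c k ^ 2 := pow_pos (hc k) 2
        have := (div_le_iff₀ hck).1 ht.1
        linarith
      · have : c k ^ 2 * t < 0 := mul_neg_of_pos_of_neg (pow_pos (hc k) 2) ht.2
        linarith
    have h := gaussian_bounds_zoom (E := EuclideanSpace ℝ (Fin 3)) (G := Gb) (T := ν * T) (x₀ := x₀)
      (c₁ := c₁ * ν ^ ((3:ℝ) / 2)) (c₂ := c₂ / ν) (C₁ := C₁ * ν ^ ((3:ℝ) / 2)) (C₂ := C₂ / ν)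
      (hc k) ht.2.le y (by
        rw [h3']
        exact hGbb _ ht' (x₀ + c k • y))
    rw [h3', h3] at h
    exact h
  · -- frequencies: `Λ_k(τ) = Λ♭(νT + c_k² τ) = Λ(T + c_k² τ / ν)`
    intro k τ
    have e1 := adaptedFrequency_zoom ub Gb (ν * T) x₀ (hc k) τ
    have e2 := adaptedFrequency_viscosity u G T hν (ν * T + c k ^ 2 * τ)
    rw [hullTransfer_zoomTime_eq hν.ne'] at e2
    exact e1.trans e2
  · -- pinching: `(−τ)² H_k(τ) = (T − t)² H(t)`, `t = T + c_k² τ / ν ∈ [tₚ, T)`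
    intro k τ hτ hτp
    have e1 := adaptedEnstrophy_zoom ub Gb (ν * T) x₀ (hc k) τ
    have e2 := adaptedEnstrophy_viscosity u G ν (ν * T + c k ^ 2 * τ)
    rw [hullTransfer_zoomTime_eq hν.ne'] at e2
    have e3 : (-τ) ^ 2 * adaptedEnstrophy (w k) (g k) τ =
        (T - (T + c k ^ 2 * τ / ν)) ^ 2 * adaptedEnstrophy u G (T + c k ^ 2 * τ / ν) := by
      rw [← hullTransfer_pinch_rescale hν.ne' T (c k) τ, ← e2, ← e1]
    have hmem : T + c k ^ 2 * τ / ν ∈ Ico tₚ T := by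
      refine ⟨hτp, ?_⟩
      have h1 : c k ^ 2 * τ / ν < 0 :=
        div_neg_of_neg_of_pos (mul_neg_of_pos_of_neg (pow_pos (hc k) 2) hτ) hν
      linarith
    rw [e3]
    exact hpinch _ hmem

end Summit.NavierStokesRegularity.NavierStokesRegularity.Theorems

end
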